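import Mathlib
import HarnessLib
import Summits.Parity.GeneralizedHardyLittlewood.Theorems.TypeIILiouville.Negative.TypeIILiouvilleLoadBearing

/-!
# `TypeIILiouville` (stmt-Parity-13322): the crux's shape is false for every periodic pretender

Negative lemma (disprover's record, cycle 1, part 2) for the crux `LiouvilleMAD.TypeIILiouville`,
in the notation `TypeIIShape f c` of `TypeIILiouvilleLoadBearing` (the crux's inequality with a
general weight `f` in place of `λ`; `TypeIILiouville → ∀ c ≠ 0, TypeIIShape lam c`).

`not_typeIIShape_of_periodic`: if `f` is `q`-periodic (`q ≥ 1`) and `f r ≠ 0` for some `r`, then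
`TypeIIShape f c` is false for EVERY shift `c`. Witness: `M = qM'`, `N = qN'`, `α = 1_{m ≡ 1 (q)}`,
`β = 1_{n ≡ r-c (q)}`; then `f(mn+c) = f(r)` on the whole sub-box (density `q^{-2}`), so
`|B| = |f r|·#A·#B` while the right side is `C √#A √#B √(MN) (N^{-1/2} + M^{-η}) = o(#A #B)`.
Corollaries: `not_typeIIShape_const` (the main-term ghost `f ≡ v ≠ 0`) and
`not_typeIIShape_dirichlet` — the shape fails for every real Dirichlet character of any modulus in
place of `λ` (the Landau–Siegel caricature `λ ≈ χ (mod q)`). Consequence for provers: boundedness,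
complete multiplicativity and mean zero of `λ` cannot prove the crux; any proof must separate `λ`
from ALL periodic functions with a power saving at scale `M^η` (power non-pretentiousness, i.e.
zero-free-strip strength — cf. the negative line `Sketch`, `TypeIILiouville → quasi-RH`). [folklore]
-/

namespace Summit.Parity.GeneralizedHardyLittlewood.Theorems.TypeIILiouville.Negative

open Finset Filter
open Summit.Parity.GeneralizedHardyLittlewood.Theses.LiouvilleMAD

/-- Indicator of the residue class `a mod q`. -/
def indQ (q a : ℕ) (m : ℕ) : ℝ := if m % q = a then 1 else 0

/-- `indQ q a` is `{0,1}`-valued. -/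
theorem indQ_sq (q a m : ℕ) : indQ q a m ^ 2 = indQ q a m := by
  unfold indQ; split <;> norm_num

/-- The representative of `a mod q` in `[1, q]`. -/
def rep (q a : ℕ) : ℕ := if a = 0 then q else a

/-- `1 ≤ rep q a` for `q ≥ 1`. -/
theorem rep_pos {q : ℕ} (a : ℕ) (hq : 1 ≤ q) : 1 ≤ rep q a := by
  unfold rep; split <;> omega

/-- `rep q a ≤ q` for `a < q`. -/
theorem rep_le {q a : ℕ} (haq : a < q) : rep q a ≤ q := by
  unfold rep; split <;> omega

/-- `rep q a ≡ a (mod q)`. -/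
theorem rep_mod {q a : ℕ} (haq : a < q) : rep q a % q = a := by
  unfold rep; split
  · subst_vars; exact Nat.mod_self q
  · exact Nat.mod_eq_of_lt haq

/-- At least `L` elements of `(qL, 2qL]` lie in any residue class `a mod q` (`a < q`). -/
theorem le_card_filter_mod (q L a : ℕ) (hq : 1 ≤ q) (haq : a < q) :
    L ≤ ((Ioc (q * L) (2 * (q * L))).filter (fun m => m % q = a)).card := by
  have hinj : Set.InjOn (fun j => q * (L + j) + rep q a) (range L : Set ℕ) := by
    intro x _ y _ hxy
    simp only at hxy
    have h1 : q * (L + x) = q * (L + y) := Nat.add_right_cancel hxy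
    have h2 := Nat.eq_of_mul_eq_mul_left (by omega : 0 < q) h1
    omega
  calc L = (range L).card := (card_range L).symm
    _ = ((range L).image (fun j => q * (L + j) + rep q a)).card := (card_image_of_injOn hinj).symm
    _ ≤ _ := by
      apply card_le_card
      intro m hm
      simp only [mem_image, mem_range] at hm
      obtain ⟨j, hj, rfl⟩ := hm
      simp only [mem_filter, mem_Ioc]
      refine ⟨⟨?_, ?_⟩, ?_⟩
      · calc q * L ≤ q * (L + j) := Nat.mul_le_mul_left q (by omega)
          _ < q * (L + j) + rep q a := Nat.lt_add_of_pos_right (rep_pos a hq)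
      · calc q * (L + j) + rep q a ≤ q * (L + j) + q := Nat.add_le_add_left (rep_le haq) _
          _ = q * (L + j + 1) := by ring
          _ ≤ q * (2 * L) := Nat.mul_le_mul_left q (by omega)
          _ = 2 * (q * L) := by ring
      · rw [Nat.mul_add_mod_self_left, rep_mod haq]

/-- CARICATURE, general form: the crux's shape is false at every shift for EVERY `q`-periodic weight
that is not identically zero. -/
theorem not_typeIIShape_of_periodic {f : ℕ → ℝ} {q : ℕ} (hq : 1 ≤ q)
    (hper : ∀ k, f (k + q) = f k) {r : ℕ} (hr : f r ≠ 0) (c : ℤ) : ¬ TypeIIShape f c := by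
  rintro ⟨η, hη, C, h⟩
  have hper' : ∀ t k, f (k + q * t) = f k := by
    intro t
    induction t with
    | zero => intro k; simp
    | succ t ih => intro k; rw [Nat.mul_succ, ← add_assoc, hper, ih]
  -- residues: `m ≡ 1`, `n ≡ b :≡ r - c (mod q)`, so that `mn + c ≡ r (mod q)`
  set b : ℕ := Int.toNat (((r : ℤ) - c) % q) with hb_def
  have hq0 : (0 : ℤ) < q := by exact_mod_cast hq
  have hbq : b < q := by have := Int.emod_lt_of_pos ((r : ℤ) - c) hq0; omega
  have hb : (b : ℤ) = ((r : ℤ) - c) % q := by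
    have := Int.emod_nonneg ((r : ℤ) - c) hq0.ne'; omega
  have h1q : 1 % q < q := Nat.mod_lt 1 (by omega)
  -- thresholds
  have hvpos : 0 < |f r| := abs_pos.mpr hr
  have hqR : (0 : ℝ) < q := by exact_mod_cast hq
  have hε : 0 < |f r| / (2 * q) := by positivity
  have hu : Tendsto (fun L : ℕ => ((q * L : ℕ) : ℝ)) atTop atTop :=
    tendsto_natCast_atTop_atTop.comp
      (tendsto_atTop_mono (fun L => show id L ≤ q * L by
        dsimp only [id]; exact Nat.le_mul_of_pos_left L (by omega)) tendsto_id)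
  obtain ⟨N', hN'1, hN'a⟩ := ((eventually_ge_atTop 1).and
    (eventually_const_mul_rpow_neg_lt C (by norm_num : (0 : ℝ) < 1 / 2) hε hu)).exists
  obtain ⟨M', hM'N, hM'c, hM'b⟩ := ((eventually_ge_atTop N').and
    ((eventually_ge_atTop (r + Int.toNat (-c))).and
    (eventually_const_mul_rpow_neg_lt C hη hε hu))).exists
  replace hN'a : C * ((q * N' : ℕ) : ℝ) ^ (-(1 / 2 : ℝ)) < |f r| / (2 * q) := hN'a
  replace hM'b : C * ((q * M' : ℕ) : ℝ) ^ (-η) < |f r| / (2 * q) := hM'b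
  have hqN1 : 1 ≤ q * N' := Nat.succ_le_of_lt (Nat.mul_pos (by omega) (by omega))
  have hbox := h (q * M') (q * N') hqN1 (Nat.mul_le_mul_left q hM'N) (indQ q (1 % q)) (indQ q b)
  -- every surviving term is `f r`
  have hterm : ∀ m ∈ Ioc (q * M') (2 * (q * M')), ∀ n ∈ Ioc (q * N') (2 * (q * N')),
      indQ q (1 % q) m * indQ q b n * f (Int.toNat ((m : ℤ) * n + c)) =
        indQ q (1 % q) m * indQ q b n * f r := by
    intro m hm n hn
    rw [mem_Ioc] at hm hn
    by_cases hma : m % q = 1 % q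
    · by_cases hnb : n % q = b
      · -- `mn ≡ b (mod q)` in `ℕ`
        have hk : (m * n) % q = b := by
          rw [Nat.mul_mod, hma, hnb, Nat.mod_mul_mod, one_mul, Nat.mod_eq_of_lt hbq]
        -- size: `mn + c ≥ m - |c| > r`
        have hmn : (m : ℤ) ≤ (m : ℤ) * n :=
          le_mul_of_one_le_right (by positivity) (by exact_mod_cast (show 1 ≤ n by nlinarith))
        have hm1 : (q : ℤ) * M' + 1 ≤ m := by exact_mod_cast hm.1
        have hM'1 : (M' : ℤ) ≤ (q : ℤ) * M' := by exact_mod_cast Nat.le_mul_of_pos_left M' (by omega)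
        have hzr : (r : ℤ) ≤ (m : ℤ) * n + c := by
          have := Int.self_le_toNat (-c); omega
        -- divisibility: `mn + c - r = q · w`
        have hd : ((m * n : ℕ) : ℤ) = b + q * ((m * n / q : ℕ) : ℤ) := by
          have := Nat.mod_add_div (m * n) q
          rw [hk] at this
          exact_mod_cast this.symm
        have he : (r : ℤ) - c = b + q * (((r : ℤ) - c) / q) := by
          rw [hb]; exact (Int.emod_add_mul_ediv _ _).symm
        have hw : (m : ℤ) * n + c - r = q * (((m * n / q : ℕ) : ℤ) - ((r : ℤ) - c) / q) := by
          have hd' : (m : ℤ) * n = b + q * ((m * n / q : ℕ) : ℤ) := by exact_mod_cast hd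
          linear_combination hd' - he
        set w : ℤ := ((m * n / q : ℕ) : ℤ) - ((r : ℤ) - c) / q with hw_def
        have hw0 : 0 ≤ w := nonneg_of_mul_nonneg_right (by rw [← hw]; linarith) hq0
        -- so `toNat (mn + c) = r + q * toNat w`
        have hK : Int.toNat ((m : ℤ) * n + c) = r + q * Int.toNat w := by
          have h0 : 0 ≤ (m : ℤ) * n + c := by linarith [hzr]
          have h1 : ((Int.toNat ((m : ℤ) * n + c) : ℕ) : ℤ) = ((r + q * Int.toNat w : ℕ) : ℤ) := by
            rw [Int.toNat_of_nonneg h0]; push_cast; rw [Int.toNat_of_nonneg hw0]; linarith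
          exact_mod_cast h1
        rw [hK, hper' (Int.toNat w) r]
      · simp [indQ, hnb]
    · simp [indQ, hma]
  have hsum : ∑ m ∈ Ioc (q * M') (2 * (q * M')), ∑ n ∈ Ioc (q * N') (2 * (q * N')),
      indQ q (1 % q) m * indQ q b n * f (Int.toNat ((m : ℤ) * n + c)) =
      (((Ioc (q * M') (2 * (q * M'))).filter (fun m => m % q = 1 % q)).card : ℝ) *
      (((Ioc (q * N') (2 * (q * N'))).filter (fun n => n % q = b)).card : ℝ) * f r := by
    rw [sum_congr rfl fun m hm => sum_congr rfl fun n hn => hterm m hm n hn]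
    simp_rw [← sum_mul]
    rw [← sum_mul_sum]
    simp only [indQ, sum_boole]
  have hsqA : ∑ m ∈ Ioc (q * M') (2 * (q * M')), indQ q (1 % q) m ^ 2 =
      (((Ioc (q * M') (2 * (q * M'))).filter (fun m => m % q = 1 % q)).card : ℝ) := by
    simp only [indQ_sq]; simp only [indQ, sum_boole]
  have hsqB : ∑ n ∈ Ioc (q * N') (2 * (q * N')), indQ q b n ^ 2 =
      (((Ioc (q * N') (2 * (q * N'))).filter (fun n => n % q = b)).card : ℝ) := by
    simp only [indQ_sq]; simp only [indQ, sum_boole]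
  rw [hsum, hsqA, hsqB] at hbox
  set x : ℝ := (((Ioc (q * M') (2 * (q * M'))).filter (fun m => m % q = 1 % q)).card : ℝ) with hx
  set y : ℝ := (((Ioc (q * N') (2 * (q * N'))).filter (fun n => n % q = b)).card : ℝ) with hy
  have hxM : (M' : ℝ) ≤ x := by rw [hx]; exact_mod_cast le_card_filter_mod q M' (1 % q) hq h1q
  have hyN : (N' : ℝ) ≤ y := by rw [hy]; exact_mod_cast le_card_filter_mod q N' b hq hbq
  have hM'pos : (0 : ℝ) < M' := by exact_mod_cast (hN'1.trans hM'N)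
  have hN'pos : (0 : ℝ) < N' := by exact_mod_cast hN'1
  have hxpos : 0 < x := hM'pos.trans_le hxM
  have hypos : 0 < y := hN'pos.trans_le hyN
  have hP : Real.sqrt (((q * M' : ℕ) : ℝ) * ((q * N' : ℕ) : ℝ)) = q * (Real.sqrt M' * Real.sqrt N') := by
    push_cast
    rw [show (q : ℝ) * M' * (q * N') = (q * q) * ((M' : ℝ) * N') by ring,
      Real.sqrt_mul (by positivity), Real.sqrt_mul_self hqR.le, Real.sqrt_mul hM'pos.le]
  have hst : Real.sqrt M' * Real.sqrt N' ≤ Real.sqrt x * Real.sqrt y :=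
    mul_le_mul (Real.sqrt_le_sqrt hxM) (Real.sqrt_le_sqrt hyN) (Real.sqrt_nonneg _)
      (Real.sqrt_nonneg _)
  have htpos : 0 < Real.sqrt M' * Real.sqrt N' :=
    mul_pos (Real.sqrt_pos.mpr hM'pos) (Real.sqrt_pos.mpr hN'pos)
  have hspos : 0 < Real.sqrt x * Real.sqrt y := htpos.trans_le hst
  rw [hP, abs_mul, abs_of_nonneg (by positivity : (0 : ℝ) ≤ x * y)] at hbox
  have hxy : x * y = (Real.sqrt x * Real.sqrt y) * (Real.sqrt x * Real.sqrt y) := by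
    rw [show Real.sqrt x * Real.sqrt y * (Real.sqrt x * Real.sqrt y) =
      (Real.sqrt x * Real.sqrt x) * (Real.sqrt y * Real.sqrt y) by ring,
      Real.mul_self_sqrt hxpos.le, Real.mul_self_sqrt hypos.le]
  rw [hxy] at hbox
  -- `|f r| · s ≤ C q t X`
  have hs_le : Real.sqrt x * Real.sqrt y * |f r| ≤ C * (q * (Real.sqrt M' * Real.sqrt N')) *
      ((((q * N' : ℕ) : ℝ)) ^ (-(1 / 2 : ℝ)) + (((q * M' : ℕ) : ℝ)) ^ (-η)) := by
    refine le_of_mul_le_mul_left ?_ hspos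
    calc Real.sqrt x * Real.sqrt y * (Real.sqrt x * Real.sqrt y * |f r|)
        = Real.sqrt x * Real.sqrt y * (Real.sqrt x * Real.sqrt y) * |f r| := by ring
      _ ≤ C * Real.sqrt x * Real.sqrt y * (q * (Real.sqrt M' * Real.sqrt N')) *
          ((((q * N' : ℕ) : ℝ)) ^ (-(1 / 2 : ℝ)) + (((q * M' : ℕ) : ℝ)) ^ (-η)) := hbox
      _ = Real.sqrt x * Real.sqrt y * (C * (q * (Real.sqrt M' * Real.sqrt N')) *
          ((((q * N' : ℕ) : ℝ)) ^ (-(1 / 2 : ℝ)) + (((q * M' : ℕ) : ℝ)) ^ (-η))) := by ring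
  have hCX : C * (((q * N' : ℕ) : ℝ)) ^ (-(1 / 2 : ℝ)) + C * (((q * M' : ℕ) : ℝ)) ^ (-η) <
      |f r| / q := by
    have : |f r| / (2 * q) + |f r| / (2 * q) = |f r| / q := by field_simp; ring
    linarith
  have hkey : C * (q * (Real.sqrt M' * Real.sqrt N')) *
      ((((q * N' : ℕ) : ℝ)) ^ (-(1 / 2 : ℝ)) + (((q * M' : ℕ) : ℝ)) ^ (-η)) <
      (Real.sqrt M' * Real.sqrt N') * |f r| := by
    have := mul_lt_mul_of_pos_left hCX (mul_pos hqR htpos)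
    calc C * (q * (Real.sqrt M' * Real.sqrt N')) *
        ((((q * N' : ℕ) : ℝ)) ^ (-(1 / 2 : ℝ)) + (((q * M' : ℕ) : ℝ)) ^ (-η))
        = (q * (Real.sqrt M' * Real.sqrt N')) * (C * (((q * N' : ℕ) : ℝ)) ^ (-(1 / 2 : ℝ)) +
            C * (((q * M' : ℕ) : ℝ)) ^ (-η)) := by ring
      _ < (q * (Real.sqrt M' * Real.sqrt N')) * (|f r| / q) := this
      _ = (Real.sqrt M' * Real.sqrt N') * |f r| := by field_simp
  nlinarith

/-- Corollary: the shape fails for every constant nonzero weight (e.g. `f ≡ 1`, the main-term ghost). -/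
theorem not_typeIIShape_const {v : ℝ} (hv : v ≠ 0) (c : ℤ) : ¬ TypeIIShape (fun _ => v) c :=
  not_typeIIShape_of_periodic (q := 1) le_rfl (fun _ => rfl) (r := 0) hv c

/-- Corollary: the shape fails for every real Dirichlet character of any modulus `q ≥ 1` in place of
`λ` (the Landau–Siegel caricature `λ ≈ χ (mod q)` — e.g. a quadratic `χ` with an exceptional zero),
at every shift. -/
theorem not_typeIIShape_dirichlet {q : ℕ} [NeZero q] (χ : DirichletCharacter ℝ q) (c : ℤ) :
    ¬ TypeIIShape (fun k => χ (k : ZMod q)) c :=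
  not_typeIIShape_of_periodic (q := q) (Nat.one_le_iff_ne_zero.mpr (NeZero.ne q))
    (fun k => by simp) (r := 1) (by simp) c

end Summit.Parity.GeneralizedHardyLittlewood.Theorems.TypeIILiouville.Negative
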